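import Literature.NumberTheory.LFunctions.DirichletLAtZero
import HarnessLib

/-!
# The Stickelberger elements `f_i`, `e_i = (1 - ι) f_i` of `ℤ[Gal(ℚ(ζ_p)/ℚ)]` and their independence

[Schoof2009, Chapter 9] Let `p` be an odd prime, `G = Gal(ℚ(ζ_p)/ℚ) = {σ_a : a ∈ (ℤ/pℤ)ˣ}`,
`θ_i = ∑_a [ia/p] σ_a⁻¹`, `f_i = θ_{i+1} - θ_i = ∑_a m_{i,a} σ_a⁻¹` and
`e_i = (1 - ι) f_i = ∑_a u_{i,a} σ_a⁻¹` (`ι = σ_{-1}` complex conjugation). We work with the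
coefficient functions `a ↦ m_{i,a}`, `a ↦ u_{i,a}` on `(ℤ/pℤ)ˣ` (an element `∑_a n_a σ_a⁻¹` of
`ℤ[G]` *is* its coefficient function) and prove:

* `Catalan.fCoeff`, `Catalan.eCoeff` — `m_{i,a} = [(i+1)a/p] - [ia/p]`
  (`coeffM_eq_div_sub_div`), `u_{i,a} = m_{i,a} - m_{i,-a}`;
* [Schoof2009, Proposition 9.4]: `m_{i,a} ∈ {0, 1}`, `m_{i,a} + m_{i,p-a} = 1` and
  `u_{i,a} = ±1`, `u_{i,-a} = -u_{i,a}` for `1 ≤ i ≤ p - 2` (`coeffM_add_coeffM_neg`,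
  `coeffU_eq_one_or`, `coeffU_neg`);
* the character values ([Schoof2009, Lemma 9.1 (ii) and proof of Theorem 9.3]):
  `p · m_{i,a} = a + (ia mod p) - ((i+1)a mod p)` (`natCast_mul_coeffM`), hence for a Dirichlet
  character `χ` mod `p`, `p ∑_a m_{i,a} χ(a) = (1 + χ(i)⁻¹ - χ(i+1)⁻¹) ∑_a a χ(a)` and
  `∑_a u_{i,a} χ(a) = (1 - χ(-1)) ∑_a m_{i,a} χ(a)`;
* **[Schoof2009, Theorem 9.3 (ii)] (independence half)**: for `p ≥ 5` the elements
  `e_1, …, e_{(p-1)/2}` are `ℤ`-linearly independent (`coeffU_linearIndependent`). Schoof deduces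
  this from the rank count `dim_ℂ I ⊗ ℂ = #{χ odd : B_{1,χ} ≠ 0} = (p-1)/2`; we use the same
  analytic input `B_{1,χ} ≠ 0` for odd `χ` (`LValueZero.unitHom_sum_val_mul_ne_zero`, i.e.
  `L(0, χ) ≠ 0`, [Washington1997, Theorem 4.2]) and finish with the orthogonality relations and an
  explicit `(p-1)/2 × (p-1)/2` unimodular-up-to-`p` linear system instead of Proposition 9.2.

Everything is proved; no definitions (the coefficient function is a parameter pinned down by an
explicit `if`-term hypothesis `hM`); no named facts.

## References

* R. Schoof, *Catalan's Conjecture*, Universitext, Springer 2009 [Schoof2009], Chapter 9: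
  Lemma 9.1, Theorem 9.3, Proposition 9.4 (book pp. 55–58) — held,
  `lit read book:schoof2009-catalan-s-conjecture` (PDF pp. 138–142).
* L. C. Washington, *Introduction to Cyclotomic Fields*, GTM 83, §6.2 and Theorem 4.2
  [Washington1997].
-/

namespace Literature.NumberTheory.DiophantineGeometry

namespace Catalan

open Finset

variable {p : ℕ} [hp : Fact p.Prime]

/-! ### The coefficients `m_{i,a}` and `u_{i,a}` -/

/-! We take the coefficient function `M i a = m_{i,a}` as a *parameter* characterised by the
hypothesis `hM` (an explicit `if`-term), so that no definition is introduced: `m_{i,a} = 1` if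
`(ia mod p) + a ≥ p` and `0` otherwise [Schoof2009, Ch. 9, p. 57] (`= [(i+1)a/p] - [ia/p]`,
`coeffM_eq_div_sub_div`); and `u_{i,a} = m_{i,a} - m_{i,-a}` is written `M i a - M i (-a)`. -/

variable {M : ℕ → (ZMod p)ˣ → ℤ}
  (hM : ∀ (i : ℕ) (a : (ZMod p)ˣ),
    M i a = if p ≤ ((i : ZMod p) * a).val + (a : ZMod p).val then 1 else 0)

include hM

/-- `m_{i,a} = [(i+1)a/p] - [ia/p]` with `a ∈ [1, p-1]` the representative — Schoof's definition
of the coefficients of `f_i = θ_{i+1} - θ_i`, `θ_i = ∑_a [ia/p] σ_a⁻¹`.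
[cite: Schoof2009, Ch. 9, Definition p. 55 and p. 57] -/
theorem coeffM_eq_div_sub_div (i : ℕ) (a : (ZMod p)ˣ) :
    M i a = (((i + 1) * (a : ZMod p).val / p : ℕ) : ℤ) - ((i * (a : ZMod p).val / p : ℕ) : ℤ) := by
  have hp0 : 0 < p := hp.out.pos
  set v := (a : ZMod p).val with hv
  have hvp : v < p := ZMod.val_lt _
  have hmul : ((i : ZMod p) * a).val = i * v % p := by
    rw [ZMod.val_mul, ZMod.val_natCast, Nat.mod_mul_mod]
  have hdiv : (i + 1) * v / p = i * v / p + (if p ≤ i * v % p + v then 1 else 0) := by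
    rw [show (i + 1) * v = i * v + v by ring, Nat.add_div hp0, Nat.div_eq_of_lt hvp,
      Nat.mod_eq_of_lt hvp, add_zero]
  rw [hM, hmul, hdiv]
  push_cast
  split_ifs <;> simp

/-- `m_{i,a} ∈ {0, 1}`. [cite: Schoof2009, Proposition 9.4 (proof)] -/
theorem coeffM_eq_zero_or_one (i : ℕ) (a : (ZMod p)ˣ) : M i a = 0 ∨ M i a = 1 := by
  rw [hM]
  split_ifs <;> simp

/-- The basic linear relation behind [Schoof2009, Lemma 9.1 (ii)] (`p θ_i = (i - σ_i) θ_p`):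
`p · m_{i,a} = a + (ia mod p) - ((i+1)a mod p)`, all representatives in `[0, p-1]`. [cite: Schoof2009, Lemma 9.1 (ii)] -/
theorem natCast_mul_coeffM (i : ℕ) (a : (ZMod p)ˣ) :
    (p : ℤ) * M i a = ((a : ZMod p).val : ℤ) + ((((i : ZMod p) * a).val : ℕ) : ℤ) -
      (((((i + 1 : ℕ) : ZMod p) * a).val : ℕ) : ℤ) := by
  haveI : NeZero p := ⟨hp.out.ne_zero⟩
  set v := (a : ZMod p).val with hv
  set r := ((i : ZMod p) * a).val with hr
  have hvp : v < p := ZMod.val_lt _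
  have hrp : r < p := ZMod.val_lt _
  have hsucc : (((i + 1 : ℕ) : ZMod p) * a).val = (r + v) % p := by
    rw [Nat.cast_add, Nat.cast_one, add_mul, one_mul, ZMod.val_add]
  rw [hM, hsucc]
  by_cases h : p ≤ r + v
  · rw [if_pos h, Nat.mod_eq_sub_mod h, Nat.mod_eq_of_lt (by omega)]
    omega
  · rw [if_neg h, Nat.mod_eq_of_lt (by omega)]
    push_cast
    omega

/-- `m_{i,a} + m_{i,-a} = 1` for `1 ≤ i ≤ p - 2` (as `(1 + ι) f_i` is the trace).
[cite: Schoof2009, Proposition 9.4] -/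
theorem coeffM_add_coeffM_neg {i : ℕ} (hi1 : 1 ≤ i) (hi2 : i ≤ p - 2) (a : (ZMod p)ˣ) :
    M i a + M i (-a) = 1 := by
  haveI : NeZero p := ⟨hp.out.ne_zero⟩
  have hp2 := hp.out.two_le
  set v := (a : ZMod p).val with hv
  set w : ZMod p := (i : ZMod p) * a with hw
  have ha0 : (a : ZMod p) ≠ 0 := a.ne_zero
  have hi0 : (i : ZMod p) ≠ 0 := by
    rw [Ne, ZMod.natCast_eq_zero_iff]
    exact fun h => by have := Nat.le_of_dvd (by omega) h; omega
  have hi1' : ((i + 1 : ℕ) : ZMod p) ≠ 0 := by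
    rw [Ne, ZMod.natCast_eq_zero_iff]
    exact fun h => by have := Nat.le_of_dvd (by omega) h; omega
  have hw0 : w ≠ 0 := mul_ne_zero hi0 ha0
  have hvp : v < p := ZMod.val_lt _
  have hv0 : 0 < v := by
    rw [hv, Nat.pos_iff_ne_zero, Ne, ZMod.val_eq_zero]; exact ha0
  have hwp : w.val < p := ZMod.val_lt _
  have hwv0 : 0 < w.val := by
    rw [Nat.pos_iff_ne_zero, Ne, ZMod.val_eq_zero]; exact hw0
  -- `w.val + v ≠ p` since `(i+1) a ≠ 0`
  have hne : w.val + v ≠ p := by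
    intro h
    have h1 : (((i + 1 : ℕ) : ZMod p) * a).val = 0 := by
      rw [Nat.cast_add, Nat.cast_one, add_mul, one_mul, ZMod.val_add, ← hw, ← hv, h,
        Nat.mod_self]
    rw [ZMod.val_eq_zero] at h1
    exact mul_ne_zero hi1' ha0 h1
  have hnegv : ((-a : (ZMod p)ˣ) : ZMod p).val = p - v := by
    rw [Units.val_neg, ZMod.neg_val, if_neg ha0]
  have hnegw : ((i : ZMod p) * ((-a : (ZMod p)ˣ) : ZMod p)).val = p - w.val := by
    rw [Units.val_neg, mul_neg, ← hw, ZMod.neg_val, if_neg hw0]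
  rw [hM, hM, hnegv, hnegw]
  by_cases h : p ≤ w.val + v
  · rw [if_pos h, if_neg (by omega)]; norm_num
  · rw [if_neg h, if_pos (by omega)]; norm_num

/-- `u_{i,a} = 2 m_{i,a} - 1`, so `u_{i,a} = ±1`: half of the coefficients of `e_i` are `1`, the
others `-1`. [cite: Schoof2009, Proposition 9.4] -/
theorem coeffU_eq_two_mul_sub_one {i : ℕ} (hi1 : 1 ≤ i) (hi2 : i ≤ p - 2) (a : (ZMod p)ˣ) :
    (M i a - M i (-a)) = 2 * M i a - 1 := by
  have := coeffM_add_coeffM_neg hM hi1 hi2 a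
  omega

/-- `u_{i,a} = ±1`. [cite: Schoof2009, Proposition 9.4] -/
theorem coeffU_eq_one_or {i : ℕ} (hi1 : 1 ≤ i) (hi2 : i ≤ p - 2) (a : (ZMod p)ˣ) :
    (M i a - M i (-a)) = 1 ∨ (M i a - M i (-a)) = -1 := by
  rw [coeffU_eq_two_mul_sub_one hM hi1 hi2]
  rcases coeffM_eq_zero_or_one hM i a with h | h <;> rw [h] <;> norm_num

/-- `|u_{i,a}| = 1`. [cite: Schoof2009, Proposition 9.4] -/
theorem abs_coeffU {i : ℕ} (hi1 : 1 ≤ i) (hi2 : i ≤ p - 2) (a : (ZMod p)ˣ) :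
    |(M i a - M i (-a))| = 1 := by
  rcases coeffU_eq_one_or hM hi1 hi2 a with h | h <;> rw [h] <;> norm_num

omit hM in
/-- `e_i` is anti-invariant under `ι`: `u_{i,-a} = -u_{i,a}`. [cite: Schoof2009, Ch. 9 (`e_i = (1-ι) f_i`)] -/
theorem coeffU_neg (i : ℕ) (a : (ZMod p)ˣ) : (M i (-a) - M i (- -a)) = -(M i a - M i (-a)) := by
  rw [neg_neg]
  ring

/-- The size `‖e_i‖ = ∑_a |u_{i,a}| = p - 1`. [cite: Schoof2009, proof of Proposition 11.3] -/
theorem sum_abs_coeffU {i : ℕ} (hi1 : 1 ≤ i) (hi2 : i ≤ p - 2) :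
    ∑ a : (ZMod p)ˣ, |(M i a - M i (-a))| = p - 1 := by
  rw [Finset.sum_congr rfl (fun a _ => abs_coeffU hM hi1 hi2 a), Finset.sum_const, Finset.card_univ,
    ZMod.card_units_eq_totient, Nat.totient_prime hp.out]
  have := hp.out.one_le
  simp
  omega


/-! ### Character values -/

omit hM in
/-- Reindexing: `∑_a val(u a) χ(a) = χ(u⁻¹) ∑_a val(a) χ(a)` for a unit `u`. [folklore] -/
theorem sum_val_mul_mul_eq (χ : DirichletCharacter ℂ p) (u : (ZMod p)ˣ) :
    ∑ a : (ZMod p)ˣ, ((((u : ZMod p) * a).val : ℕ) : ℂ) * χ a =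
      χ (↑u⁻¹ : ZMod p) * ∑ a : (ZMod p)ˣ, (((a : ZMod p).val : ℕ) : ℂ) * χ a := by
  rw [Finset.mul_sum]
  refine Fintype.sum_equiv (Equiv.mulLeft u) _ _ (fun a => ?_)
  simp only [Equiv.coe_mulLeft, Units.val_mul]
  rw [show χ (a : ZMod p) = χ (↑u⁻¹ : ZMod p) * χ ((u : ZMod p) * a) by
    rw [← map_mul, ← mul_assoc, ← Units.val_mul, inv_mul_cancel, Units.val_one, one_mul]]
  ring

/-- **[Schoof2009, Lemma 9.1 (ii) / proof of Theorem 9.3] for `f_i`**: for a Dirichlet character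
`χ` mod `p` and `i` with `i, i+1` units mod `p` (i.e. `1 ≤ i ≤ p - 2`),
`p ∑_a m_{i,a} χ(a) = (1 + χ(i)⁻¹ - χ(i+1)⁻¹) ∑_a a χ(a)`. [cite: Schoof2009, Theorem 9.3 (proof)] -/
theorem natCast_mul_sum_coeffM_mul (i : ℕ) (χ : DirichletCharacter ℂ p) {u u' : (ZMod p)ˣ}
    (hu : (u : ZMod p) = i) (hu' : (u' : ZMod p) = (i + 1 : ℕ)) :
    (p : ℂ) * ∑ a : (ZMod p)ˣ, ((M i a : ℤ) : ℂ) * χ a =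
      (1 + χ (↑u⁻¹ : ZMod p) - χ (↑u'⁻¹ : ZMod p)) *
        ∑ a : (ZMod p)ˣ, (((a : ZMod p).val : ℕ) : ℂ) * χ a := by
  have hterm : ∀ a : (ZMod p)ˣ, (p : ℂ) * (((M i a : ℤ) : ℂ) * χ a) =
      (((a : ZMod p).val : ℕ) : ℂ) * χ a + ((((i : ZMod p) * a).val : ℕ) : ℂ) * χ a -
        (((((i + 1 : ℕ) : ZMod p) * a).val : ℕ) : ℂ) * χ a := by
    intro a
    have h := natCast_mul_coeffM hM i a
    have h' : (p : ℂ) * ((M i a : ℤ) : ℂ) = (((a : ZMod p).val : ℕ) : ℂ) +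
        ((((i : ZMod p) * a).val : ℕ) : ℂ) - (((((i + 1 : ℕ) : ZMod p) * a).val : ℕ) : ℂ) := by
      exact_mod_cast h
    rw [← mul_assoc, h']
    ring
  rw [Finset.mul_sum, Finset.sum_congr rfl (fun a _ => hterm a), Finset.sum_sub_distrib,
    Finset.sum_add_distrib]
  simp_rw [← hu', ← hu]
  rw [sum_val_mul_mul_eq χ u, sum_val_mul_mul_eq χ u']
  ring

omit hM in
/-- `∑_a u_{i,a} χ(a) = (1 - χ(-1)) ∑_a m_{i,a} χ(a)`: the character values of
`e_i = (1 - ι) f_i` vanish at even `χ` and are twice those of `f_i` at odd `χ`.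
[cite: Schoof2009, Theorem 9.3 (proof)] -/
theorem sum_coeffU_mul (i : ℕ) (χ : DirichletCharacter ℂ p) :
    ∑ a : (ZMod p)ˣ, (((M i a - M i (-a)) : ℤ) : ℂ) * χ a =
      (1 - χ (-1)) * ∑ a : (ZMod p)ˣ, ((M i a : ℤ) : ℂ) * χ a := by
  have hneg : ∑ a : (ZMod p)ˣ, ((M i (-a) : ℤ) : ℂ) * χ a =
      χ (-1) * ∑ a : (ZMod p)ˣ, ((M i a : ℤ) : ℂ) * χ a := by
    rw [Finset.mul_sum]
    refine Fintype.sum_equiv (Equiv.neg _) _ _ (fun a => ?_)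
    simp only [Equiv.neg_apply, Units.val_neg]
    rw [show χ (a : ZMod p) = χ (-1) * χ (-(a : ZMod p)) by
      rw [← map_mul, neg_mul_neg, one_mul]]
    ring
  simp only [Int.cast_sub, sub_mul, Finset.sum_sub_distrib, hneg]
  ring

/-! ### Independence of `e_1, …, e_{(p-1)/2}` ([Schoof2009, Theorem 9.3 (ii)]) -/

omit hM in
/-- Orthogonality: a function on `ℤ/pℤ` all of whose Dirichlet-character sums vanish is zero on
the units. [folklore] -/
theorem eq_zero_of_forall_sum_mul_char_eq_zero (f : ZMod p → ℂ)
    (h : ∀ χ : DirichletCharacter ℂ p, ∑ b : ZMod p, f b * χ b = 0) {a : ZMod p}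
    (ha : IsUnit a) : f a = 0 := by
  haveI : NeZero p := ⟨hp.out.ne_zero⟩
  haveI : NeZero (Monoid.exponent (ZMod p)ˣ) :=
    ⟨Monoid.exponent_ne_zero.mpr Monoid.ExponentExists.of_finite⟩
  have key : ∑ χ : DirichletCharacter ℂ p, χ a⁻¹ * ∑ b : ZMod p, f b * χ b =
      (p.totient : ℂ) * f a := by
    calc ∑ χ : DirichletCharacter ℂ p, χ a⁻¹ * ∑ b : ZMod p, f b * χ b
        = ∑ b : ZMod p, f b * ∑ χ : DirichletCharacter ℂ p, χ a⁻¹ * χ b := by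
          simp_rw [Finset.mul_sum]
          rw [Finset.sum_comm]
          refine Finset.sum_congr rfl fun b _ => Finset.sum_congr rfl fun χ _ => ?_
          ring
      _ = ∑ b : ZMod p, f b * (if a = b then (p.totient : ℂ) else 0) := by
          refine Finset.sum_congr rfl fun b _ => ?_
          rw [DirichletCharacter.sum_char_inv_mul_char_eq ℂ ha b]
      _ = (p.totient : ℂ) * f a := by
          simp only [mul_ite, mul_zero, Finset.sum_ite_eq, Finset.mem_univ, if_true]
          ring
  have h0 : ∑ χ : DirichletCharacter ℂ p, χ a⁻¹ * ∑ b : ZMod p, f b * χ b = 0 := by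
    simp [h]
  rw [h0] at key
  have htot : (p.totient : ℂ) ≠ 0 := Nat.cast_ne_zero.mpr (Nat.totient_pos.mpr hp.out.pos).ne'
  exact (mul_eq_zero.mp key.symm).resolve_left htot

omit hM in
/-- The sum `S_χ = ∑_{a ∈ (ℤ/pℤ)ˣ} a χ(a)` (`= p B_{1,χ}`) over the units equals the sum over all
residues. [folklore] -/
theorem sum_units_val_mul_eq (χ : DirichletCharacter ℂ p) :
    ∑ a : (ZMod p)ˣ, (((a : ZMod p).val : ℕ) : ℂ) * χ a = ∑ a : ZMod p, (a.val : ℂ) * χ a := by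
  refine Finset.sum_bij_ne_zero (fun a _ _ => (a : ZMod p)) (fun a _ _ => Finset.mem_univ _)
    (fun a₁ _ _ a₂ _ _ h => Units.ext h) (fun b _ hb => ?_) (fun a _ _ => rfl)
  have hb0 : b ≠ 0 := by
    rintro rfl
    simp at hb
  exact ⟨Units.mk0 b hb0, Finset.mem_univ _, by rwa [Units.val_mk0], Units.val_mk0 hb0⟩

omit hM in
/-- For an odd character `χ` mod `p`: `S_χ = ∑_{a ∈ (ℤ/pℤ)ˣ} a χ(a) ≠ 0` (i.e. `B_{1,χ} ≠ 0`;
`LValueZero.sum_val_mul_ne_zero_of_odd`). [cite: Washington1997, Theorem 4.2] -/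
theorem sum_units_val_mul_ne_zero {χ : DirichletCharacter ℂ p} (hχ : χ.Odd) :
    ∑ a : (ZMod p)ˣ, (((a : ZMod p).val : ℕ) : ℂ) * χ a ≠ 0 := by
  rw [sum_units_val_mul_eq]
  exact Literature.NumberTheory.LFunctions.LValueZero.sum_val_mul_ne_zero_of_odd hχ

omit hM in
/-- `χ(-1) = ±1` for a Dirichlet character with values in `ℂ`. [folklore] -/
theorem char_neg_one_sq (χ : DirichletCharacter ℂ p) : χ (-1) = 1 ∨ χ (-1) = -1 := by
  have h : χ (-1) * χ (-1) = 1 := by rw [← map_mul, neg_mul_neg, one_mul, map_one]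
  have : (χ (-1) - 1) * (χ (-1) + 1) = 0 := by linear_combination h
  rcases mul_eq_zero.mp this with h1 | h1
  · exact Or.inl (by linear_combination h1)
  · exact Or.inr (by linear_combination h1)

/-- **[Schoof2009, Theorem 9.3 (ii)], independence.** For a prime `p ≥ 5` the elements
`e_1, …, e_{(p-1)/2}` of `I = (1 - ι) 𝒮 ⊂ ℤ[G]` are `ℤ`-linearly independent: if
`∑_{i=1}^{(p-1)/2} c_i e_i = 0` then all `c_i = 0`. (Schoof: they form a `ℤ`-basis of `I`; the
proof rests on `B_{1,χ} ≠ 0` for the odd characters `χ`, [Schoof2009, Proposition 7.5], here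
`sum_units_val_mul_ne_zero`.) [cite: Schoof2009, Theorem 9.3 (ii)] -/
theorem coeffU_linearIndependent (hp5 : 5 ≤ p) {c : ℕ → ℤ}
    (h : ∀ a : (ZMod p)ˣ, ∑ i ∈ Icc 1 ((p - 1) / 2), c i * (M i a - M i (-a)) = 0) :
    ∀ i ∈ Icc 1 ((p - 1) / 2), c i = 0 := by
  classical
  haveI : NeZero p := ⟨hp.out.ne_zero⟩
  -- `p = 2m + 1`, `m ≥ 2`
  obtain ⟨m, hm⟩ : ∃ m, p = 2 * m + 1 := hp.out.odd_of_ne_two (by omega)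
  have hm2 : 2 ≤ m := by omega
  have hmdef : (p - 1) / 2 = m := by omega
  rw [hmdef] at h ⊢
  -- natural numbers `j < p` as elements of `ZMod p`: injectivity and inverses
  have hcast_inj : ∀ {j k : ℕ}, j < p → k < p → ((j : ZMod p) = k ↔ j = k) := by
    intro j k hj hk
    constructor
    · intro e
      have := congrArg ZMod.val e
      rwa [ZMod.val_cast_of_lt hj, ZMod.val_cast_of_lt hk] at this
    · rintro rfl; rfl
  have hcast_ne : ∀ {j : ℕ}, 1 ≤ j → j < p → (j : ZMod p) ≠ 0 := by
    intro j hj1 hjp e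
    have := (hcast_inj hjp hp.out.pos).mp (by simpa using e)
    omega
  -- Step 1: the character relations `W(χ) = 0` for odd `χ`
  have hW : ∀ χ : DirichletCharacter ℂ p, χ (-1) = -1 →
      ∑ i ∈ Icc 1 m, (c i : ℂ) * (1 + χ ((i : ZMod p)⁻¹) - χ (((i + 1 : ℕ) : ZMod p)⁻¹)) = 0 := by
    intro χ hχ
    set S : ℂ := ∑ a : (ZMod p)ˣ, (((a : ZMod p).val : ℕ) : ℂ) * χ a with hS
    have hS0 : S ≠ 0 := sum_units_val_mul_ne_zero hχ
    -- units `u_i`, `u_{i+1}`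
    have hrel : ∀ i ∈ Icc 1 m, (p : ℂ) * ∑ a : (ZMod p)ˣ, (((M i a - M i (-a)) : ℤ) : ℂ) * χ a =
        2 * ((1 + χ ((i : ZMod p)⁻¹) - χ (((i + 1 : ℕ) : ZMod p)⁻¹)) * S) := by
      intro i hi
      rw [mem_Icc] at hi
      have hi1 : 1 ≤ i := hi.1
      have hip : i < p := by omega
      have hi1p : i + 1 < p := by omega
      set u : (ZMod p)ˣ := ZMod.unitOfCoprime i
        (Nat.coprime_of_lt_prime (by omega) hip hp.out).symm with hu
      set u' : (ZMod p)ˣ := ZMod.unitOfCoprime (i + 1)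
        (Nat.coprime_of_lt_prime (by omega) hi1p hp.out).symm with hu'
      have hcu : (u : ZMod p) = i := ZMod.coe_unitOfCoprime _ _
      have hcu' : (u' : ZMod p) = (i + 1 : ℕ) := ZMod.coe_unitOfCoprime _ _
      rw [sum_coeffU_mul, hχ, sub_neg_eq_add, show (1 : ℂ) + 1 = 2 by norm_num,
        mul_left_comm, natCast_mul_sum_coeffM_mul hM i χ hcu hcu', Units.val_inv_eq_inv_val,
        Units.val_inv_eq_inv_val, hcu, hcu']
    have hsum : ∑ a : (ZMod p)ˣ, (∑ i ∈ Icc 1 m, (c i : ℂ) * (((M i a - M i (-a)) : ℤ) : ℂ)) * χ a = 0 := by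
      refine Finset.sum_eq_zero fun a _ => ?_
      have := h a
      rw [mul_eq_zero]; left
      exact_mod_cast this
    have hswap : ∑ a : (ZMod p)ˣ, (∑ i ∈ Icc 1 m, (c i : ℂ) * (((M i a - M i (-a)) : ℤ) : ℂ)) * χ a =
        ∑ i ∈ Icc 1 m, (c i : ℂ) * ∑ a : (ZMod p)ˣ, (((M i a - M i (-a)) : ℤ) : ℂ) * χ a := by
      simp_rw [Finset.sum_mul, Finset.mul_sum, mul_assoc]
      exact Finset.sum_comm
    have hcalc : (p : ℂ) * ∑ i ∈ Icc 1 m, (c i : ℂ) * ∑ a : (ZMod p)ˣ, (((M i a - M i (-a)) : ℤ) : ℂ) * χ a =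
        2 * S * ∑ i ∈ Icc 1 m, (c i : ℂ) *
          (1 + χ ((i : ZMod p)⁻¹) - χ (((i + 1 : ℕ) : ZMod p)⁻¹)) := by
      rw [Finset.mul_sum, Finset.mul_sum]
      refine Finset.sum_congr rfl fun i hi => ?_
      rw [mul_left_comm, hrel i hi]
      ring
    rw [← hswap, hsum, mul_zero] at hcalc
    have h2S : (2 : ℂ) * S ≠ 0 := mul_ne_zero two_ne_zero hS0
    exact (mul_eq_zero.mp hcalc.symm).resolve_left h2S
  -- Step 2: the test function `F` and its antisymmetrisation are killed by all characters
  set F : ZMod p → ℂ := fun b => ∑ i ∈ Icc 1 m, (c i : ℂ) *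
    ((if b = 1 then 1 else 0) + (if b = ((i : ZMod p))⁻¹ then 1 else 0) -
      (if b = (((i + 1 : ℕ) : ZMod p))⁻¹ then 1 else 0)) with hF
  have hFsum : ∀ χ : DirichletCharacter ℂ p, ∑ b : ZMod p, F b * χ b =
      ∑ i ∈ Icc 1 m, (c i : ℂ) * (1 + χ ((i : ZMod p)⁻¹) - χ (((i + 1 : ℕ) : ZMod p)⁻¹)) := by
    intro χ
    simp only [hF, Finset.sum_mul]
    rw [Finset.sum_comm]
    refine Finset.sum_congr rfl fun i _ => ?_
    simp only [mul_assoc, ← Finset.mul_sum]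
    congr 1
    simp only [add_mul, sub_mul, Finset.sum_add_distrib, Finset.sum_sub_distrib, ite_mul, one_mul,
      zero_mul, Finset.sum_ite_eq', Finset.mem_univ, if_true, map_one]
  set G : ZMod p → ℂ := fun b => F b - F (-b) with hG
  have hGsum : ∀ χ : DirichletCharacter ℂ p, ∑ b : ZMod p, G b * χ b = 0 := by
    intro χ
    have hreindex : ∑ b : ZMod p, F (-b) * χ b = χ (-1) * ∑ b : ZMod p, F b * χ b := by
      rw [Finset.mul_sum]
      refine Fintype.sum_equiv (Equiv.neg _) _ _ (fun b => ?_)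
      simp only [Equiv.neg_apply]
      rw [show χ b = χ (-1) * χ (-b) by rw [← map_mul, neg_mul_neg, one_mul]]
      ring
    simp only [hG, sub_mul, Finset.sum_sub_distrib, hreindex]
    rcases char_neg_one_sq χ with he | ho
    · rw [he]; ring
    · rw [hFsum, hW χ ho]; ring
  have hG0 : ∀ {j : ℕ}, 1 ≤ j → j < p → G ((j : ZMod p)⁻¹) = 0 := by
    intro j hj1 hjp
    refine eq_zero_of_forall_sum_mul_char_eq_zero G hGsum ?_
    exact (IsUnit.mk0 _ (hcast_ne hj1 hjp)).inv
  -- Step 3: evaluate `G` at `k⁻¹`, `1 ≤ k ≤ m`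
  have hinv1 : ∀ {k : ℕ}, 1 ≤ k → k < p → (((k : ZMod p)⁻¹ = 1) ↔ k = 1) := by
    intro k hk1 hkp
    rw [inv_eq_one, ← Nat.cast_one, hcast_inj hkp hp.out.one_lt]
  have hinvinv : ∀ {j k : ℕ}, j < p → k < p → (((k : ZMod p)⁻¹ = ((j : ZMod p))⁻¹) ↔ k = j) := by
    intro j k hj hk
    rw [inv_inj, hcast_inj hk hj]
  have hneg_inv : ∀ {k : ℕ}, k < p → -((k : ZMod p)⁻¹) = (((p - k : ℕ) : ZMod p))⁻¹ := by
    intro k hk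
    rw [Nat.cast_sub hk.le, ZMod.natCast_self, zero_sub, inv_neg]
  have hFk : ∀ k ∈ Icc 1 m, F ((k : ZMod p)⁻¹) =
      (if k = 1 then ∑ i ∈ Icc 1 m, (c i : ℂ) else 0) + c k -
        (if 2 ≤ k then (c (k - 1) : ℂ) else 0) := by
    intro k hk
    rw [mem_Icc] at hk
    have hkp : k < p := by omega
    have step : F ((k : ZMod p)⁻¹) = ∑ i ∈ Icc 1 m, (c i : ℂ) *
        ((if k = 1 then 1 else 0) + (if k = i then 1 else 0) - (if k = i + 1 then 1 else 0)) := by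
      simp only [hF]
      refine Finset.sum_congr rfl fun i hi => ?_
      rw [mem_Icc] at hi
      simp only [hinv1 hk.1 hkp, hinvinv (by omega : i < p) hkp, hinvinv (by omega : i + 1 < p) hkp]
    rw [step]
    simp only [mul_add, mul_sub, Finset.sum_add_distrib, Finset.sum_sub_distrib, mul_ite, mul_one,
      mul_zero]
    have s1 : ∑ i ∈ Icc 1 m, (if k = 1 then (c i : ℂ) else 0) =
        if k = 1 then ∑ i ∈ Icc 1 m, (c i : ℂ) else 0 := by
      split_ifs <;> simp
    have s2 : ∑ i ∈ Icc 1 m, (if k = i then (c i : ℂ) else 0) = c k := by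
      rw [Finset.sum_ite_eq, if_pos (mem_Icc.mpr hk)]
    have s3 : ∑ i ∈ Icc 1 m, (if k = i + 1 then (c i : ℂ) else 0) =
        if 2 ≤ k then (c (k - 1) : ℂ) else 0 := by
      by_cases h2 : 2 ≤ k
      · rw [if_pos h2]
        have e3 : ∀ i ∈ Icc 1 m, (if k = i + 1 then (c i : ℂ) else 0) =
            if k - 1 = i then (c i : ℂ) else 0 := by
          intro i _
          have : (k = i + 1) ↔ (k - 1 = i) := by omega
          simp only [this]
        rw [Finset.sum_congr rfl e3, Finset.sum_ite_eq, if_pos (mem_Icc.mpr ⟨by omega, by omega⟩)]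
      · rw [if_neg h2]
        refine Finset.sum_eq_zero fun i hi => ?_
        rw [mem_Icc] at hi
        rw [if_neg (by omega)]
    rw [s1, s2, s3]
  have hFnegk : ∀ k ∈ Icc 1 m, F (-((k : ZMod p)⁻¹)) = -(if k = m then (c m : ℂ) else 0) := by
    intro k hk
    rw [mem_Icc] at hk
    have hkp : k < p := by omega
    have hpk1 : 1 ≤ p - k := by omega
    have hpkp : p - k < p := by omega
    rw [hneg_inv hkp]
    have step : F (((p - k : ℕ) : ZMod p)⁻¹) = ∑ i ∈ Icc 1 m, (c i : ℂ) *
        ((if p - k = 1 then 1 else 0) + (if p - k = i then 1 else 0) -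
          (if p - k = i + 1 then 1 else 0)) := by
      simp only [hF]
      refine Finset.sum_congr rfl fun i hi => ?_
      rw [mem_Icc] at hi
      simp only [hinv1 hpk1 hpkp, hinvinv (by omega : i < p) hpkp, hinvinv (by omega : i + 1 < p) hpkp]
    rw [step]
    have e4 : ∀ i ∈ Icc 1 m, (c i : ℂ) * ((if p - k = 1 then 1 else 0) +
        (if p - k = i then 1 else 0) - (if p - k = i + 1 then 1 else 0)) =
          -(if m = i then (if k = m then (c m : ℂ) else 0) else 0) := by
      intro i hi
      rw [mem_Icc] at hi
      rw [if_neg (by omega : p - k ≠ 1), if_neg (by omega : p - k ≠ i)]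
      by_cases h1 : p - k = i + 1
      · have him : i = m := by omega
        have hkm : k = m := by omega
        subst him
        rw [if_pos h1, if_pos rfl, if_pos hkm]
        ring
      · rw [if_neg h1]
        by_cases him : m = i
        · subst him
          rw [if_pos rfl, if_neg (by omega)]
          ring
        · rw [if_neg him]
          ring
    rw [Finset.sum_congr rfl e4, Finset.sum_neg_distrib, Finset.sum_ite_eq,
      if_pos (mem_Icc.mpr ⟨by omega, le_rfl⟩)]
  have hEq : ∀ k ∈ Icc 1 m,
      (if k = 1 then ∑ i ∈ Icc 1 m, (c i : ℂ) else 0) + c k -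
        (if 2 ≤ k then (c (k - 1) : ℂ) else 0) + (if k = m then (c m : ℂ) else 0) = 0 := by
    intro k hk
    have hk' := hk
    rw [mem_Icc] at hk'
    have := hG0 hk'.1 (by omega)
    simp only [hG] at this
    rw [hFk k hk, hFnegk k hk, sub_neg_eq_add] at this
    exact this
  -- Step 4: solve the linear system
  have hchain : ∀ k, 2 ≤ k → k ≤ m - 1 → (c k : ℂ) = c (k - 1) := by
    intro k hk2 hkm
    have := hEq k (mem_Icc.mpr ⟨by omega, by omega⟩)
    rw [if_neg (by omega), if_pos hk2, if_neg (by omega)] at this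
    linear_combination this
  have hconst : ∀ k, 1 ≤ k → k ≤ m - 1 → (c k : ℂ) = c 1 := by
    intro k hk1 hkm
    induction k with
    | zero => omega
    | succ k ih =>
      rcases Nat.lt_or_ge k 1 with hk | hk
      · have : k = 0 := by omega
        subst this; rfl
      · rw [hchain (k + 1) (by omega) hkm, Nat.add_sub_cancel, ih hk (by omega)]
  have hlast : 2 * (c m : ℂ) = c (m - 1) := by
    have := hEq m (mem_Icc.mpr ⟨by omega, le_rfl⟩)
    rw [if_neg (by omega), if_pos hm2, if_pos rfl] at this
    linear_combination this
  have hfirst : ∑ i ∈ Icc 1 m, (c i : ℂ) + c 1 = 0 := by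
    have := hEq 1 (mem_Icc.mpr ⟨le_rfl, by omega⟩)
    rw [if_pos rfl, if_neg (by omega), if_neg (by omega)] at this
    linear_combination this
  have hsplit : ∑ i ∈ Icc 1 m, (c i : ℂ) = (m - 1 : ℕ) * (c 1 : ℂ) + c m := by
    have hunion : Icc 1 m = Icc 1 (m - 1) ∪ {m} := by
      ext i
      simp only [mem_union, mem_Icc, mem_singleton]
      omega
    have hdisj : Disjoint (Icc 1 (m - 1)) {m} := by
      rw [Finset.disjoint_singleton_right, mem_Icc]
      omega
    rw [hunion, Finset.sum_union hdisj, Finset.sum_singleton]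
    congr 1
    have hc' : ∀ i ∈ Icc 1 (m - 1), (c i : ℂ) = c 1 := fun i hi => by
      rw [mem_Icc] at hi
      exact hconst i hi.1 hi.2
    rw [Finset.sum_congr rfl hc', Finset.sum_const, Nat.card_Icc, nsmul_eq_mul, Nat.add_sub_cancel]
  have hc1 : (c 1 : ℂ) = 2 * c m := by
    rw [hlast, hconst (m - 1) (by omega) le_rfl]
  have hcm : (c m : ℂ) = 0 := by
    have hp0 : (p : ℂ) ≠ 0 := Nat.cast_ne_zero.mpr hp.out.ne_zero
    have hm1 : ((m - 1 : ℕ) : ℂ) = (m : ℂ) - 1 := by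
      rw [Nat.cast_sub (by omega : 1 ≤ m), Nat.cast_one]
    have : (p : ℂ) * c m = 0 := by
      rw [hsplit, hc1, hm1] at hfirst
      rw [hm]
      push_cast
      linear_combination hfirst
    exact (mul_eq_zero.mp this).resolve_left hp0
  -- conclusion
  intro i hi
  rw [mem_Icc] at hi
  have : (c i : ℂ) = 0 := by
    rcases Nat.lt_or_ge i m with him | him
    · rw [hconst i hi.1 (by omega), hc1, hcm, mul_zero]
    · have : i = m := le_antisymm hi.2 him
      rw [this, hcm]
  exact_mod_cast this

end Catalan

end Literature.NumberTheory.DiophantineGeometry
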